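import Summits.QuantumFields.GaugeBoot.TiltedBoxAxisRPNegative
import HarnessLib

/-!
# The square tilted box of ODD side: the axis coordinate, the twisted slab and the half-space weights (gauge-boot, L3 negative supplement; twisted-slab mechanism, box geometry)

HONEST FRAMING (cell `pub-gaugeboot`, page 1 of every file): the venture produces certified bounds
on lattice expectations at stated coupling, gauge group, dimension and torus size; NOT a mass gap,
NOT a continuum limit, NOT a string tension; NOT Yang–Mills-summit-bearing (barriers
`FixedCouplingUltralocality`, `PerturbativeInvisibility`). Geometry for the NEGATIVE result
`TiltedBoxOddAxisRPNegative.lean` (in-plane axis reflection positivity fails on the square tilted box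
of odd side in `d ≥ 3`), complementing `TiltedBoxAxisRPNegative.lean` (even side).

On the SQUARE tilted box `ℤ^d / Γ(M, M, L)` the coordinate `x_i` is defined modulo `M`
(`axisCoord`; `Γ ∋ x ⇒ 2M ∣ 2x_i`). For ODD `M = 2P + 1` the flip `Θ_i : x_i ↦ -x_i`
(`tiltedAxisFlip`) fixes the layer `x_i ≡ 0` pointwise and maps the layer `x_i ≡ P` onto the
ADJACENT layer `x_i ≡ P + 1`, but TWISTED: **`tiltedAxisFlip_of_axisCoord_eq`**,
`Θ_i y = y + e_i + T` with the half-period translation `T = [M e_j]` (`tiltedTwist`; `T + T = 0`,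
`T ≠ 0`), because `M e_i ≡ M e_j (mod Γ)`. So `Θ_i` is a HYBRID frame: a site mirror at `x_i = 0` and
a twisted link mirror at `x_i = P + ½`. This file records:

* `axisCoord`, `axisHeight2 = 2 x_i mod 2M` (the height through which the closed half
  `{0 ≤ x_i ≤ P (mod M)}` is an `IsHalfObservable` half, `inHalf_iff`), their values on `e_k`, `T`,
  and under the flip;
* the twist lemma and `tiltedAxisFlip_tiltedTwist`, `tiltedTwist_add_tiltedTwist`;
* the HALF-SPACE WEIGHTS `halfWeight p ∈ {0, ½, 1}` of the plaquettes (`1` inside the closed half,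
  `½` inside the fixed layer, `0` else) and the identity behind the cancellation of the Boltzmann
  weight, **`halfWeight_add_halfWeight_plaqReflect`**:
  `c_p + c_{Θp} = 1` for every plaquette EXCEPT the slab plaquettes (`IsSlabPlaq`: an `i`-side,
  based in the layer `x_i ≡ P`), where it is `0`;
* `isHalfLink_of_halfWeight_ne_zero`: plaquettes with non-zero weight have all four links in the
  closed half.

Everything is `[folklore]` bookkeeping (FILS 1980 §3 describes the box; the twist is elementary).

References: J. Fröhlich, R. Israel, E. H. Lieb, B. Simon, J. Stat. Phys. 22 (1980) 297, §3;
K. Osterwalder, E. Seiler, Ann. Phys. 110 (1978) 440, §2.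
-/

noncomputable section

open QuotientAddGroup

namespace Summit.QuantumFields.GaugeBoot

namespace TiltedRP

section Box

variable (d : ℕ) {i j : Fin d} (L M : ℕ)

/-! ## The axis coordinate `x_i mod M` of the square box -/

/-- **The coordinate `x_i mod M` of the square tilted box** `Γ(M, M, L)` (well defined: `x ∈ Γ` gives
`2M ∣ (x_i + x_j) + (x_i - x_j) = 2x_i`). [folklore] -/
def axisCoord : TiltedSite d i j M M L →+ ZMod M :=
  QuotientAddGroup.lift _ ((Int.castAddHom (ZMod M)).comp (Pi.evalAddMonoidHom (fun _ : Fin d => ℤ) i))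
    (by
      intro x hx
      rw [mem_tiltedLattice_iff] at hx
      obtain ⟨h1, h2, -⟩ := hx
      rw [AddMonoidHom.mem_ker]
      simp only [AddMonoidHom.coe_comp, Function.comp_apply, Pi.evalAddMonoidHom_apply,
        Int.coe_castAddHom, ZMod.intCast_zmod_eq_zero_iff_dvd]
      have h3 : (((2 * M : ℕ)) : ℤ) ∣ (x i + x j) + (x i - x j) := dvd_add h1 h2
      rw [show x i + x j + (x i - x j) = 2 * x i by ring] at h3
      have h4 : (2 : ℤ) * M ∣ 2 * x i := by push_cast at h3; exact h3
      exact (mul_dvd_mul_iff_left (two_ne_zero : (2 : ℤ) ≠ 0)).1 h4)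

/-- The coordinate on classes. [folklore] -/
theorem axisCoord_mk (x : Fin d → ℤ) :
    axisCoord d L M (x : TiltedSite d i j M M L) = ((x i : ℤ) : ZMod M) := rfl

/-- The flip negates the coordinate. [folklore] -/
theorem axisCoord_tiltedAxisFlip (hij : i ≠ j) (q : TiltedSite d i j M M L) :
    axisCoord d L M (tiltedAxisFlip d L M hij q) = -axisCoord d L M q := by
  induction q using QuotientAddGroup.induction_on with
  | H x => rw [tiltedAxisFlip_mk, axisCoord_mk, axisCoord_mk, negHom_apply, if_pos rfl, Int.cast_neg]

/-- The coordinate of `e_i` is `1`. [folklore] -/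
theorem axisCoord_tiltedUnit_self : axisCoord d L M (tiltedUnit d i j M M L i) = 1 := by
  rw [tiltedUnit, axisCoord_mk, Pi.single_eq_same, Int.cast_one]

/-- The coordinate of `e_k`, `k ≠ i`, is `0`. [folklore] -/
theorem axisCoord_tiltedUnit_of_ne {k : Fin d} (hk : k ≠ i) :
    axisCoord d L M (tiltedUnit d i j M M L k) = 0 := by
  rw [tiltedUnit, axisCoord_mk, Pi.single_eq_of_ne (Ne.symm hk), Int.cast_zero]

/-- `x_i(q + e_k) = x_i(q) + [k = i]`. [folklore] -/
theorem axisCoord_add_tiltedUnit (q : TiltedSite d i j M M L) (k : Fin d) :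
    axisCoord d L M (q + tiltedUnit d i j M M L k) = axisCoord d L M q + if k = i then 1 else 0 := by
  rw [map_add]
  by_cases hk : k = i
  · subst hk; rw [axisCoord_tiltedUnit_self, if_pos rfl]
  · rw [axisCoord_tiltedUnit_of_ne d L M hk, if_neg hk]

/-- **The doubled height `2 x_i mod 2M`** — the closed half `{0 ≤ x_i ≤ P (mod M)}` of the odd
box `M = 2P + 1` is `{(2x_i mod 2M) ≤ M}`, the shape of the tree's `IsHalfObservable`. [folklore] -/
def axisHeight2 : TiltedSite d i j M M L →+ ZMod (2 * M) :=
  QuotientAddGroup.lift _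
    ((Int.castAddHom (ZMod (2 * M))).comp ((2 : ℕ) • Pi.evalAddMonoidHom (fun _ : Fin d => ℤ) i))
    (by
      intro x hx
      rw [mem_tiltedLattice_iff] at hx
      obtain ⟨h1, h2, -⟩ := hx
      rw [AddMonoidHom.mem_ker]
      simp only [AddMonoidHom.coe_comp, Function.comp_apply, AddMonoidHom.smul_apply,
        Pi.evalAddMonoidHom_apply, Int.coe_castAddHom, ZMod.intCast_zmod_eq_zero_iff_dvd]
      have h3 : (((2 * M : ℕ)) : ℤ) ∣ (x i + x j) + (x i - x j) := dvd_add h1 h2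
      rw [show x i + x j + (x i - x j) = 2 * x i by ring] at h3
      exact_mod_cast h3)

/-- The doubled height on classes. [folklore] -/
theorem axisHeight2_mk (x : Fin d → ℤ) :
    axisHeight2 d L M (x : TiltedSite d i j M M L) = ((2 * x i : ℤ) : ZMod (2 * M)) := by
  show ((Int.castAddHom (ZMod (2 * M))).comp ((2 : ℕ) • Pi.evalAddMonoidHom (fun _ : Fin d => ℤ) i)) x = _
  simp

/-- `(2x_i mod 2M) = 2 · (x_i mod M)` as natural numbers. [folklore] -/
theorem axisHeight2_val [NeZero M] (q : TiltedSite d i j M M L) :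
    (axisHeight2 d L M q).val = 2 * (axisCoord d L M q).val := by
  haveI : NeZero (2 * M) := ⟨by have := NeZero.ne M; omega⟩
  induction q using QuotientAddGroup.induction_on with
  | H x =>
    have h1 : (((axisHeight2 d L M (x : TiltedSite d i j M M L)).val : ℕ) : ℤ) = (2 * x i) % (2 * M : ℕ) := by
      rw [axisHeight2_mk, ZMod.val_intCast]
    have h2 : (((axisCoord d L M (x : TiltedSite d i j M M L)).val : ℕ) : ℤ) = x i % (M : ℕ) := by
      rw [axisCoord_mk, ZMod.val_intCast]
    have h3 : (((axisHeight2 d L M (x : TiltedSite d i j M M L)).val : ℕ) : ℤ) =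
        2 * ((axisCoord d L M (x : TiltedSite d i j M M L)).val : ℕ) := by
      rw [h1, h2]; push_cast; exact Int.mul_emod_mul_of_pos _ _ two_pos
    exact_mod_cast h3

variable (P : ℕ)

/-- **The closed half of the odd box**: `InHalf M (2x_i) q ↔ x_i(q) ≤ P` for `M = 2P + 1`.
[folklore] -/
theorem inHalf_iff (q : TiltedSite d i j (2 * P + 1) (2 * P + 1) L) :
    InHalf (2 * P + 1) (axisHeight2 d L (2 * P + 1)) q ↔ (axisCoord d L (2 * P + 1) q).val ≤ P := by
  show (axisHeight2 d L (2 * P + 1) q).val ≤ 2 * P + 1 ↔ _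
  rw [axisHeight2_val]
  omega

/-! ## The twist -/

/-- **The half-period translation `T = [M e_j]`** of the square box. [folklore] -/
def tiltedTwist : TiltedSite d i j M M L := ((Pi.single j (M : ℤ) : Fin d → ℤ) : TiltedSite d i j M M L)

/-- `T + T = 0` (`2M e_j ∈ Γ`). [folklore] -/
theorem tiltedTwist_add_tiltedTwist (hij : i ≠ j) :
    tiltedTwist d L M + tiltedTwist d L M = (0 : TiltedSite d i j M M L) := by
  rw [tiltedTwist, ← QuotientAddGroup.mk_add, QuotientAddGroup.eq_zero_iff, mem_tiltedLattice_iff]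
  simp only [Pi.add_apply, Pi.single_eq_of_ne hij, Pi.single_eq_same]
  refine ⟨⟨1, by push_cast; ring⟩, ⟨-1, by push_cast; ring⟩, fun k hki hkj => ?_⟩
  rw [Pi.single_eq_of_ne hkj]; simp

/-- The twist has `x_i = 0`. [folklore] -/
theorem axisCoord_tiltedTwist (hij : i ≠ j) : axisCoord d L M (tiltedTwist d L M : TiltedSite d i j M M L) = 0 := by
  rw [tiltedTwist, axisCoord_mk, Pi.single_eq_of_ne hij, Int.cast_zero]

/-- The flip fixes the twist. [folklore] -/
theorem tiltedAxisFlip_tiltedTwist (hij : i ≠ j) :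
    tiltedAxisFlip d L M hij (tiltedTwist d L M) = tiltedTwist d L M := by
  rw [tiltedTwist, tiltedAxisFlip_mk]
  congr 1
  funext m
  rw [negHom_apply]
  by_cases hm : m = i
  · subst hm; rw [if_pos rfl, Pi.single_eq_of_ne hij, neg_zero]
  · rw [if_neg hm]

/-- **The twist lemma**: on the layer `x_i ≡ P` of the odd box `M = 2P + 1` the flip is
`Θ_i y = y + e_i + T` — it carries the layer onto the adjacent layer `x_i ≡ P + 1`, translated by
the half period `T = [M e_j]` (`(2P + 1) e_i ≡ (2P + 1) e_j (mod Γ)`). [folklore] -/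
theorem tiltedAxisFlip_of_axisCoord_eq (hij : i ≠ j) (q : TiltedSite d i j (2 * P + 1) (2 * P + 1) L)
    (hq : axisCoord d L (2 * P + 1) q = ((P : ℕ) : ZMod (2 * P + 1))) :
    tiltedAxisFlip d L (2 * P + 1) hij q =
      q + tiltedUnit d i j (2 * P + 1) (2 * P + 1) L i + tiltedTwist d L (2 * P + 1) := by
  induction q using QuotientAddGroup.induction_on with
  | H x =>
    rw [axisCoord_mk] at hq
    have hdvd : (((2 * P + 1 : ℕ)) : ℤ) ∣ (P : ℤ) - x i := by
      rw [← ZMod.intCast_eq_intCast_iff_dvd_sub]; exact_mod_cast hq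
    obtain ⟨a, ha⟩ := hdvd
    rw [tiltedAxisFlip_mk, tiltedUnit, tiltedTwist, ← QuotientAddGroup.mk_add, ← QuotientAddGroup.mk_add,
      QuotientAddGroup.eq, mem_tiltedLattice_iff]
    simp only [Pi.add_apply, Pi.neg_apply, negHom_apply, if_neg (Ne.symm hij), Pi.single_eq_same,
      Pi.single_eq_of_ne hij, Pi.single_eq_of_ne (Ne.symm hij)]
    have hxi : x i = (P : ℤ) - (2 * P + 1 : ℕ) * a := by linarith
    refine ⟨⟨1 - a, ?_⟩, ⟨-a, ?_⟩, fun k hki hkj => ?_⟩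
    · rw [hxi]; push_cast; ring
    · rw [hxi]; push_cast; ring
    · rw [if_neg hki, Pi.single_eq_of_ne hki, Pi.single_eq_of_ne hkj]; simp

/-! ## The half-space weights of the plaquettes -/

/-- Weight of a TRANSVERSE plaquette (no `i`-side) inside the layer `x_i ≡ a`: `½` on the fixed
layer `a = 0`, `1` inside the closed half, `0` outside. [folklore] -/
def cT (a : ZMod (2 * P + 1)) : ℝ := if a = 0 then 1 / 2 else if a.val ≤ P then 1 else 0

/-- Weight of a LONGITUDINAL plaquette (with an `i`-side) between the layers `a` and `a + 1`:
`1` if both layers are in the closed half. [folklore] -/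
def cL (a : ZMod (2 * P + 1)) : ℝ := if a.val < P then 1 else 0

/-- `cT(a) + cT(-a) = 1`: the transverse plaquettes off the fixed layer are exchanged between the two
halves, those in the fixed layer are shared. [folklore] -/
theorem cT_add_cT_neg (a : ZMod (2 * P + 1)) : cT P a + cT P (-a) = 1 := by
  unfold cT
  by_cases ha : a = 0
  · subst ha; norm_num
  · have hna : -a ≠ 0 := neg_ne_zero.2 ha
    rw [if_neg ha, if_neg hna, ZMod.neg_val, if_neg ha]
    have h1 := ZMod.val_lt a
    have h2 : a.val ≠ 0 := fun h => ha ((ZMod.val_eq_zero a).1 h)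
    by_cases hle : a.val ≤ P
    · rw [if_pos hle, if_neg (by omega)]; norm_num
    · rw [if_neg hle, if_pos (by omega)]; norm_num

/-- `cL(a) + cL(-a-1) = 1 - [a = P]`: the longitudinal plaquettes are exchanged between the halves,
EXCEPT the slab plaquettes between the layers `P` and `P + 1`, which belong to neither. [folklore] -/
theorem cL_add_cL_refl [NeZero P] (a : ZMod (2 * P + 1)) :
    cL P a + cL P (-a - 1) = if a = ((P : ℕ) : ZMod (2 * P + 1)) then 0 else 1 := by
  unfold cL
  have hP : P ≠ 0 := NeZero.ne P
  have hM1 : 2 * P + 1 ≠ 1 := by omega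
  have h1 := ZMod.val_lt a
  have hPval : (((P : ℕ) : ZMod (2 * P + 1))).val = P := by
    rw [ZMod.val_natCast]; exact Nat.mod_eq_of_lt (by omega)
  have haP : a = ((P : ℕ) : ZMod (2 * P + 1)) ↔ a.val = P := by
    constructor
    · intro h; rw [h, hPval]
    · intro h; apply ZMod.val_injective; rw [h, hPval]
  -- `(-a-1).val = 2P - a.val`
  have hneg : (-a - 1 : ZMod (2 * P + 1)).val = 2 * P - a.val := by
    rw [show (-a - 1 : ZMod (2 * P + 1)) = -(a + 1) by ring, ZMod.neg_val]
    by_cases htop : a.val = 2 * P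
    · have ha1 : a + 1 = 0 := by
        apply ZMod.val_injective
        rw [ZMod.val_add, htop, ZMod.val_one'' hM1, ZMod.val_zero]
        simp
      rw [if_pos ha1]; omega
    · have hlt : a.val + (1 : ZMod (2 * P + 1)).val < 2 * P + 1 := by
        rw [ZMod.val_one'' hM1]; omega
      have ha1 : (a + 1).val = a.val + 1 := by rw [ZMod.val_add_of_lt hlt, ZMod.val_one'' hM1]
      have hne : a + 1 ≠ 0 := fun h => by
        have := congrArg ZMod.val h; rw [ha1, ZMod.val_zero] at this; omega
      rw [if_neg hne, ha1]; omega
  rw [hneg]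
  by_cases hP : a.val = P
  · rw [if_neg (by omega), if_neg (by omega), if_pos (haP.2 hP)]; norm_num
  · rw [if_neg (fun h => hP (haP.1 h))]
    by_cases hlt : a.val < P
    · rw [if_pos hlt, if_neg (by omega)]; norm_num
    · rw [if_neg hlt, if_pos (by omega)]; norm_num

variable {d L P}

/-- **The half-space weight of a plaquette** of the odd box: `cL` of its base layer if it has an
`i`-side, `cT` otherwise. [folklore] -/
def halfWeight (p : Plaq (TiltedSite d i j (2 * P + 1) (2 * P + 1) L) d) : ℝ :=
  if p.2.1.1 = i ∨ p.2.1.2 = i then cL P (axisCoord d L (2 * P + 1) p.1)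
  else cT P (axisCoord d L (2 * P + 1) p.1)

/-- **A slab plaquette**: an `i`-side, based in the layer `x_i ≡ P` (so it connects the layer `P`
to the layer `P + 1` across the twisted mid-plane). [folklore] -/
def IsSlabPlaq (p : Plaq (TiltedSite d i j (2 * P + 1) (2 * P + 1) L) d) : Prop :=
  (p.2.1.1 = i ∨ p.2.1.2 = i) ∧ axisCoord d L (2 * P + 1) p.1 = ((P : ℕ) : ZMod (2 * P + 1))

/-- `IsSlabPlaq` is decidable. [folklore] -/
instance (p : Plaq (TiltedSite d i j (2 * P + 1) (2 * P + 1) L) d) : Decidable (IsSlabPlaq (P := P) p) := by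
  unfold IsSlabPlaq; infer_instance

/-- **The cancellation identity**: `c_p + c_{Θ p} = 0` for slab plaquettes, `= 1` for all others
(`Θ p = plaqReflect`). [folklore] -/
theorem halfWeight_add_halfWeight_plaqReflect [NeZero P] (hij : i ≠ j)
    (p : Plaq (TiltedSite d i j (2 * P + 1) (2 * P + 1) L) d) :
    halfWeight p + halfWeight (IsSiteFrame.plaqReflect (tiltedUnit d i j (2 * P + 1) (2 * P + 1) L) i
      (tiltedAxisFlip d L (2 * P + 1) hij) p) = if IsSlabPlaq (P := P) p then 0 else 1 := by
  unfold halfWeight IsSlabPlaq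
  rw [IsSiteFrame.plaqReflect_snd]
  by_cases hp : p.2.1.1 = i ∨ p.2.1.2 = i
  · rw [if_pos hp, if_pos hp, IsSiteFrame.plaqReflect_fst_of_hasDir hp, map_sub, axisCoord_tiltedAxisFlip,
      axisCoord_tiltedUnit_self, cL_add_cL_refl]
    by_cases ha : axisCoord d L (2 * P + 1) p.1 = ((P : ℕ) : ZMod (2 * P + 1))
    · rw [if_pos ha, if_pos ⟨hp, ha⟩]
    · rw [if_neg ha, if_neg (fun h => ha h.2)]
  · rw [if_neg hp, if_neg hp, IsSiteFrame.plaqReflect_fst_of_not_hasDir hp, axisCoord_tiltedAxisFlip,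
      cT_add_cT_neg, if_neg (fun h => hp h.1)]

/-! ## Plaquettes of non-zero weight lie in the closed half -/

/-- `x_i(q + e_k) ≤ P` from `x_i(q) ≤ P` for `k ≠ i`, and from `x_i(q) < P` for `k = i`. [folklore] -/
theorem axisCoord_add_val_le {q : TiltedSite d i j (2 * P + 1) (2 * P + 1) L} {k : Fin d}
    (h : if k = i then (axisCoord d L (2 * P + 1) q).val < P else (axisCoord d L (2 * P + 1) q).val ≤ P) :
    (axisCoord d L (2 * P + 1) (q + tiltedUnit d i j (2 * P + 1) (2 * P + 1) L k)).val ≤ P := by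
  rw [axisCoord_add_tiltedUnit]
  by_cases hk : k = i
  · rw [if_pos hk] at h ⊢
    have hM1 : 2 * P + 1 ≠ 1 := by omega
    have hlt : (axisCoord d L (2 * P + 1) q).val + (1 : ZMod (2 * P + 1)).val < 2 * P + 1 := by
      rw [ZMod.val_one'' hM1]; omega
    rw [ZMod.val_add_of_lt hlt, ZMod.val_one'' hM1]
    omega
  · rw [if_neg hk] at h ⊢
    rwa [add_zero]

/-- **A plaquette with non-zero half-space weight has all four links in the closed half**
`{x_i ≤ P}` (read through the doubled height). [folklore] -/
theorem isHalfLink_of_halfWeight_ne_zero {p : Plaq (TiltedSite d i j (2 * P + 1) (2 * P + 1) L) d}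
    (hp : halfWeight p ≠ 0) :
    let e := tiltedUnit d i j (2 * P + 1) (2 * P + 1) L
    IsHalfLink e (2 * P + 1) (axisHeight2 d L (2 * P + 1)) (p.1, p.2.1.1) ∧
    IsHalfLink e (2 * P + 1) (axisHeight2 d L (2 * P + 1)) (p.1 + e p.2.1.1, p.2.1.2) ∧
    IsHalfLink e (2 * P + 1) (axisHeight2 d L (2 * P + 1)) (p.1 + e p.2.1.2, p.2.1.1) ∧
    IsHalfLink e (2 * P + 1) (axisHeight2 d L (2 * P + 1)) (p.1, p.2.1.2) := by
  intro e
  -- the base layer and the admissible moves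
  have hbase : (axisCoord d L (2 * P + 1) p.1).val ≤ P ∧
      (∀ k, (k = p.2.1.1 ∨ k = p.2.1.2) →
        if k = i then (axisCoord d L (2 * P + 1) p.1).val < P
        else (axisCoord d L (2 * P + 1) p.1).val ≤ P) := by
    unfold halfWeight at hp
    by_cases hd : p.2.1.1 = i ∨ p.2.1.2 = i
    · rw [if_pos hd] at hp
      unfold cL at hp
      have hlt : (axisCoord d L (2 * P + 1) p.1).val < P := by
        by_contra h; exact hp (if_neg h)
      exact ⟨hlt.le, fun k _ => by by_cases hk : k = i <;> simp [hk, hlt, hlt.le]⟩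
    · rw [if_neg hd] at hp
      unfold cT at hp
      have hle : (axisCoord d L (2 * P + 1) p.1).val ≤ P := by
        by_cases h0 : axisCoord d L (2 * P + 1) p.1 = 0
        · rw [h0, ZMod.val_zero]; exact Nat.zero_le _
        · rw [if_neg h0] at hp
          by_contra h; exact hp (if_neg h)
      refine ⟨hle, fun k hk => ?_⟩
      have hki : k ≠ i := by
        rcases hk with rfl | rfl
        · exact fun h => hd (Or.inl h)
        · exact fun h => hd (Or.inr h)
      simp [hki, hle]
  obtain ⟨h0, hmove⟩ := hbase
  have hk := hmove p.2.1.1 (Or.inl rfl)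
  have hl := hmove p.2.1.2 (Or.inr rfl)
  -- all relevant vertices
  have v0 : InHalf (2 * P + 1) (axisHeight2 d L (2 * P + 1)) p.1 := (inHalf_iff d L P _).2 h0
  have v1 : InHalf (2 * P + 1) (axisHeight2 d L (2 * P + 1)) (p.1 + e p.2.1.1) :=
    (inHalf_iff d L P _).2 (axisCoord_add_val_le hk)
  have v2 : InHalf (2 * P + 1) (axisHeight2 d L (2 * P + 1)) (p.1 + e p.2.1.2) :=
    (inHalf_iff d L P _).2 (axisCoord_add_val_le hl)
  have v12 : InHalf (2 * P + 1) (axisHeight2 d L (2 * P + 1)) (p.1 + e p.2.1.1 + e p.2.1.2) := by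
    refine (inHalf_iff d L P _).2 (axisCoord_add_val_le ?_)
    by_cases hli : p.2.1.2 = i
    · rw [if_pos hli]
      rw [if_pos hli] at hl
      have hki : p.2.1.1 ≠ i := fun h => (ne_of_lt p.2.2) (h.trans hli.symm)
      rw [if_neg hki] at hk
      rw [axisCoord_add_tiltedUnit, if_neg hki, add_zero]
      exact hl
    · rw [if_neg hli]
      exact axisCoord_add_val_le hk
  have v21 : InHalf (2 * P + 1) (axisHeight2 d L (2 * P + 1)) (p.1 + e p.2.1.2 + e p.2.1.1) := by
    rw [add_right_comm]; exact v12
  exact ⟨⟨v0, v1⟩, ⟨v1, v12⟩, ⟨v2, v21⟩, ⟨v0, v2⟩⟩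

end Box

end TiltedRP

end Summit.QuantumFields.GaugeBoot

end
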